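import Summits.BirchSwinnertonDyer.BirchSwinnertonDyer.Theorems.GoldfeldAllTwistsTwoConverseTwinAdditiveTwoPrimesTwistSelmerPlusPOneAlpha
import HarnessLib

set_option linter.dupNamespace false -- namespace `…BirchSwinnertonDyer.BirchSwinnertonDyer…` is the cell's (D-0017 nested layout)
set_option autoImplicit false

/-!
# OBJECT A7⁺, tranche T1, file D⁺-3: the SHARP Selmer set `S(−21qp, 112q²p²) ⊆ {1, 7}` of the ODD two-prime twist `A^{(−qp)} = 49a1^{(−qp)}`
# on a71+ (`q ≡ 7 (8)`, `(q/7) = −1`; `p ≡ 1 (8)`, `(−7/p) = 1`, type α; `(p/q) = +1`) — the input of the `h2`-discharge D3⁺ (FACT-FREE)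

Cell `bsd-goldfeld`, seat `bsd-goldfeld-s1p-c3x` (gen 15); planner RULING (ccclxxxii) ORDER «OBJECT A7⁺ BY THE χ_Z CHANNEL», tranche T1
(memo `HOME/PLUS-CHIZ-CHANNEL.md` §2 D⁺). `--supports stmt-BirchSwinnertonDyer-20044` as a HELPER. Theses-free; theorems only; no definition,
no fact binder, no `sorry`. FRONTIER-grade: a twist-density-ZERO sub-family; never distance-to-summit.

WHY. `A^{(−qp)}` (good ordinary at `2`: `−qp ≡ 1 (mod 8)`) is the χ_e-partner whose rank-one input `h2 : r_an(A^{(−qp)}) = 1` the χ_Z channel needs on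
the α cells; on C7A it was discharged (D3 p670286) from the (2,4) descent D1-odd/D1-odd′ + `hpar` + `hBCST`. D1-odd (`…TwinOddTwoPrimesTwistSelmerPOne`)
kills the `p`-classes `p, 2p, 7p, 14p` at `q` by `(p/q) = −1`; on a71+ (`(p/q) = +1`) they die instead exactly as in D⁺-1: `p, 7p` AT `p` by D⁺-1's key
`not_isSquare_of_sq_sub_fortyTwo_mul_add_of_alpha` (after `V′ = 224qT`, resp. `32qT`), `2p, 14p` AT `2` (rescaled onto D0-(L2)'s numerics
`(21; 2, 56)`, `(21; 14, 8)`); the `q`-classes at `q`, `2, 14` at `2` (`u = −qp ≡ 1 (mod 8)`), negatives at `ℝ` — as D1-odd. Seat's kill table: `S = {1, 7}`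
on 20/20 a71+ rows (kit j322778: `A^{(−qp)}` ellrank 1/1/0, 20/20).
* §1 the four class kills; §2 `twoIsogenySelmerGroup_oddTwoPrimesTwist_subset_pair_plusPOneAlpha` (`S ⊆ {1, 7}`) and `card_… ≤ 2`.
HONEST FRAMING: a Selmer bound on a twist-density-ZERO cell; nothing about `L`-values; items 19140 / 19350 / 20044 unchanged; BSD is not proved by any of this.

References: [SilvermanAEC2009] Prop. X.4.9, Example X.4.10; [Serre1973] Ch. II §3.3 Thm 4; [CoatesLiTianZhai2015] §5 (type α).
-/

noncomputable section

open scoped Classical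

open WeierstrassCurve Literature.NumberTheory.EllipticCurves

namespace Summit.BirchSwinnertonDyer.BirchSwinnertonDyer.Theorems.GoldfeldGoodTwists

/-! ## §1 Local kills for `A^{(−qp)}` on a71+ -/

section LocalOdd
variable {q p : ℕ} [Fact q.Prime] [Fact p.Prime]

/-- A natural number not divisible by the prime `ℓ` is non-zero in `ZMod ℓ`, as an integer cast. [folklore] -/
private theorem intCast_ne_zero_of_not_dvd_oddPlusPOneAlpha {l : ℕ} [Fact l.Prime] {n : ℕ} (h : ¬ l ∣ n) : ((n : ℤ) : ZMod l) ≠ 0 := by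
  rw [Int.cast_natCast, Ne, ZMod.natCast_eq_zero_iff]; exact h

/-- A prime `ℓ ≠ 2, 7` divides no `2^a·7^b`. [folklore] -/
private theorem not_dvd_two_pow_mul_seven_pow_oddPlusPOneAlpha {l : ℕ} (hl : l.Prime) (hl2 : l ≠ 2) (hl7 : l ≠ 7) (a b : ℕ) :
    ¬ l ∣ 2 ^ a * 7 ^ b := by
  intro h
  rcases (Nat.Prime.dvd_mul hl).mp h with h | h
  · exact hl2 ((Nat.prime_dvd_prime_iff_eq hl Nat.prime_two).mp (hl.dvd_of_dvd_pow h))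
  · exact hl7 ((Nat.prime_dvd_prime_iff_eq hl (by norm_num)).mp (hl.dvd_of_dvd_pow h))

omit [Fact q.Prime] in
/-- **Class `p ∈ S(−21qp, 112q²p²)` dies at `p` on a71+**: `d = p·1`, `d′ = p·112q²`, `a = p·(−21q)`; a square root `T` of `112q²T² − 21qT + 1` gives
the square `V′ = 224qT = 14q·(4·√T)²` with `V′² − 42V′ + 448 = 0` (D⁺-1's key). [cite: SilvermanAEC2009, Prop. X.4.9 and Example X.4.10] -/
theorem not_isSoluble_padic_class_p_oddPlusPOneAlpha (hp8 : p % 8 = 1) (hp7 : legendreSym p (-7) = 1) (hα : ¬ ∃ x : ZMod p, x ^ 4 = -7)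
    (h14sq : IsSquare ((14 : ℤ) : ZMod p)) (hqsq : IsSquare ((q : ℤ) : ZMod p)) (h112q : ((112 * (q : ℤ) ^ 2 : ℤ) : ZMod p) ≠ 0)
    {d d' : ℤ} (hd : d = p * (1 : ℤ)) (hd' : d' = p * (112 * (q : ℤ) ^ 2)) :
    ¬ ((twoIsogenyQuartic (-21 * ((q : ℤ) * p)) d d').map (Int.castRingHom ℚ_[p])).IsSoluble := by
  refine not_isSoluble_padic_of_prime_dvd_coeffs_of_roots (p := p) (c := -21 * q) (e := 1) (e' := 112 * (q : ℤ) ^ 2) (by ring) hd hd'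
    h112q (fun T hT ↦ ?_)
  rintro ⟨X, rfl⟩
  obtain ⟨t, ht⟩ := h14sq
  obtain ⟨r, hr⟩ := hqsq
  push_cast at ht hr hT
  refine not_isSquare_of_sq_sub_fortyTwo_mul_add_of_alpha hp8 hp7 hα (V := 224 * (q : ZMod p) * (X * X)) ?_ ⟨4 * t * r * X, ?_⟩
  · linear_combination (448 : ZMod p) * hT
  · linear_combination (16 * 14 * X * X) * hr + (16 * X * X * r * r) * ht

omit [Fact q.Prime] in
/-- **Class `7p ∈ S(−21qp, 112q²p²)` dies at `p` on a71+**: `d = p·7`, `d′ = p·16q²`; a square root `T` of `16q²T² − 21qT + 7` gives the square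
`V′ = 32qT = 2q·(4·√T)²` with `V′² − 42V′ + 448 = 0`. [cite: SilvermanAEC2009, Prop. X.4.9 and Example X.4.10] -/
theorem not_isSoluble_padic_class_sevenP_oddPlusPOneAlpha (hp8 : p % 8 = 1) (hp7 : legendreSym p (-7) = 1)
    (hα : ¬ ∃ x : ZMod p, x ^ 4 = -7) (h2sq : IsSquare ((2 : ℤ) : ZMod p)) (hqsq : IsSquare ((q : ℤ) : ZMod p))
    (h16q : ((16 * (q : ℤ) ^ 2 : ℤ) : ZMod p) ≠ 0)
    {d d' : ℤ} (hd : d = p * (7 : ℤ)) (hd' : d' = p * (16 * (q : ℤ) ^ 2)) :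
    ¬ ((twoIsogenyQuartic (-21 * ((q : ℤ) * p)) d d').map (Int.castRingHom ℚ_[p])).IsSoluble := by
  refine not_isSoluble_padic_of_prime_dvd_coeffs_of_roots (p := p) (c := -21 * q) (e := 7) (e' := 16 * (q : ℤ) ^ 2) (by ring) hd hd'
    h16q (fun T hT ↦ ?_)
  rintro ⟨X, rfl⟩
  obtain ⟨t, ht⟩ := h2sq
  obtain ⟨r, hr⟩ := hqsq
  push_cast at ht hr hT
  refine not_isSquare_of_sq_sub_fortyTwo_mul_add_of_alpha hp8 hp7 hα (V := 32 * (q : ZMod p) * (X * X)) ?_ ⟨4 * t * r * X, ?_⟩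
  · linear_combination (64 : ZMod p) * hT
  · linear_combination (16 * 2 * X * X) * hr + (16 * X * X * r * r) * ht

omit [Fact q.Prime] [Fact p.Prime] in
/-- **Class `2p ∈ S(−21qp, 112q²p²)` dies at `2`** (`q ≡ 7 (8)`, `p ≡ 1 (8)`): `p ↦ 1`, `q ↦ −1` give D0-(L2)'s numeric `(21; 2, 56)`.
[cite: SilvermanAEC2009, Prop. X.4.9 and Example X.4.10] [cite: Serre1973, Ch. II §3.3 Thm 4] -/
theorem not_isSoluble_two_class_twoP_oddPlusPOne (hq8 : q % 8 = 7) (hp8 : p % 8 = 1) {a d d' : ℤ} (ha : a = -21 * ((q : ℤ) * p))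
    (hd : d = 2 * (p : ℤ)) (hd' : d' = 56 * ((q : ℤ) ^ 2 * p)) : ¬ ((twoIsogenyQuartic a d d').map (Int.castRingHom ℚ_[2])).IsSoluble :=
  fun h ↦ by
  have h1 := isSoluble_two_of_common_factor (n := p) (n₀ := 1) (by omega) (a₀ := -21 * (q : ℤ)) (d₀ := 2) (e₀ := 56 * (q : ℤ) ^ 2)
    (by rw [ha]; ring) (by rw [hd]; ring) (by rw [hd']; ring) h
  have h2 := isSoluble_two_of_sq_factor (n := q) (n₀ := -1) (by omega) (a₁ := -21) (d := 1 * 2) (e₁ := 56) (by ring) (by ring) h1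
  norm_num at h2
  exact not_isSoluble_two_numeric_two_odd_pOneAlpha h2

omit [Fact q.Prime] [Fact p.Prime] in
/-- **Class `14p ∈ S(−21qp, 112q²p²)` dies at `2`** (`q ≡ 7 (8)`, `p ≡ 1 (8)`): rescaled to D0-(L2)'s numeric `(21; 14, 8)`.
[cite: SilvermanAEC2009, Prop. X.4.9 and Example X.4.10] [cite: Serre1973, Ch. II §3.3 Thm 4] -/
theorem not_isSoluble_two_class_fourteenP_oddPlusPOne (hq8 : q % 8 = 7) (hp8 : p % 8 = 1) {a d d' : ℤ} (ha : a = -21 * ((q : ℤ) * p))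
    (hd : d = 14 * (p : ℤ)) (hd' : d' = 8 * ((q : ℤ) ^ 2 * p)) : ¬ ((twoIsogenyQuartic a d d').map (Int.castRingHom ℚ_[2])).IsSoluble :=
  fun h ↦ by
  have h1 := isSoluble_two_of_common_factor (n := p) (n₀ := 1) (by omega) (a₀ := -21 * (q : ℤ)) (d₀ := 14) (e₀ := 8 * (q : ℤ) ^ 2)
    (by rw [ha]; ring) (by rw [hd]; ring) (by rw [hd']; ring) h
  have h2 := isSoluble_two_of_sq_factor (n := q) (n₀ := -1) (by omega) (a₁ := -21) (d := 1 * 14) (e₁ := 8) (by ring) (by ring) h1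
  norm_num at h2
  exact not_isSoluble_two_numeric_fourteen_odd_pOneAlpha h2

end LocalOdd

/-! ## §2 `S(−21qp, 112q²p²) ⊆ {1, 7}` on a71+ -/

section SelmerSOdd
variable {q p : ℕ} [Fact q.Prime] [Fact p.Prime]

set_option maxHeartbeats 400000 in -- sixteen positive classes, each with its local computation (as F9a)
/-- **`S(−21qp, 112q²p²) ⊆ {1, 7}`** for `A^{(−qp)}` on a71+ (`q ≡ 7 (8)`, `(q/7) = −1`, `p ≡ 1 (8)`, `(−7/p) = 1`, type α, `(p/q) = +1`): negatives at `ℝ`,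
the `q`-classes at `q`, `p, 7p` at `p` (type α), `2p, 14p, 2, 14` at `2`. [cite: SilvermanAEC2009, Prop. X.4.9 and Example X.4.10] -/
theorem twoIsogenySelmerGroup_oddTwoPrimesTwist_subset_pair_plusPOneAlpha (hq8 : q % 8 = 7) (hq7 : jacobiSym q 7 = -1) (hp8 : p % 8 = 1)
    (hp7 : legendreSym p (-7) = 1) (hα : ¬ ∃ x : ZMod p, x ^ 4 = -7) (hpq : jacobiSym p q = 1) :
    twoIsogenySelmerGroup (-21 * ((q : ℤ) * p)) (112 * ((q : ℤ) * p) ^ 2) ⊆ ({1, 7} : Finset ℤ) := by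
  have hq : q.Prime := Fact.out
  have hp : p.Prime := Fact.out
  have hqZ : Prime (q : ℤ) := Nat.prime_iff_prime_int.mp hq
  have hpZ : Prime (p : ℤ) := Nat.prime_iff_prime_int.mp hp
  have hq0 : (q : ℤ) ≠ 0 := by exact_mod_cast hq.ne_zero
  have hp0 : (p : ℤ) ≠ 0 := by exact_mod_cast hp.ne_zero
  have hq4 : q % 4 = 3 := by omega
  have hp4 : p % 4 = 1 := by omega
  have hq2 : q ≠ 2 := by rintro rfl; norm_num at hq4
  have hp2 : p ≠ 2 := by rintro rfl; norm_num at hp4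
  have hqp : q ≠ p := by rintro rfl; omega
  have hq7' : q ≠ 7 := by
    rintro rfl; rw [jacobiSym.mod_left] at hq7; norm_num at hq7
  have hp7' : p ≠ 7 := by rintro rfl; norm_num at hp4
  obtain ⟨-, hm7q⟩ := legendreSym_seven_and_neg_seven_of_three_mod_four hq4 hq7
  obtain ⟨h2p, h7p, -⟩ := legendreSym_two_seven_neg_one_of_one_mod_eight hp8 hp7
  -- `(q/p) = (p/q) = +1`
  have hqp_p : legendreSym p q = 1 := by
    have h := legendreSym.quadratic_reciprocity_one_mod_four hp4 hq2
    rw [← jacobiSym.legendreSym.to_jacobiSym] at hpq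
    rw [← h]; exact hpq
  -- non-vanishing modulo `q` and `p`
  have hcq : ∀ a b : ℕ, (((2 ^ a * 7 ^ b : ℕ) : ℤ) : ZMod q) ≠ 0 := fun a b ↦
    intCast_ne_zero_of_not_dvd_oddPlusPOneAlpha (not_dvd_two_pow_mul_seven_pow_oddPlusPOneAlpha hq hq2 hq7' a b)
  have hcp : ∀ a b : ℕ, (((2 ^ a * 7 ^ b : ℕ) : ℤ) : ZMod p) ≠ 0 := fun a b ↦
    intCast_ne_zero_of_not_dvd_oddPlusPOneAlpha (not_dvd_two_pow_mul_seven_pow_oddPlusPOneAlpha hp hp2 hp7' a b)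
  have hpq0 : (p : ZMod q) ≠ 0 := by
    have := intCast_ne_zero_of_not_dvd_oddPlusPOneAlpha (l := q) (fun h ↦ hqp ((Nat.prime_dvd_prime_iff_eq hq hp).mp h)); exact_mod_cast this
  have hqp0 : ((q : ℤ) : ZMod p) ≠ 0 :=
    intCast_ne_zero_of_not_dvd_oddPlusPOneAlpha (l := p) (fun h ↦ hqp ((Nat.prime_dvd_prime_iff_eq hp hq).mp h).symm)
  have hpqZ : (((p : ℤ) : ℤ) : ZMod q) ≠ 0 := by exact_mod_cast hpq0
  have hns_disc_q : ¬ IsSquare ((((-21 * p) ^ 2 - 4 * (112 * p ^ 2) : ℤ)) : ZMod q) := by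
    rw [show ((-21 * p) ^ 2 - 4 * (112 * p ^ 2) : ℤ) = -7 * (p : ℤ) ^ 2 by ring]
    exact not_isSquare_mul_sq_zmod hpqZ ((legendreSym.eq_neg_one_iff q).mp hm7q)
  -- squares modulo `p`: `2`, `14`, `q`; non-vanishing of `112q²`, `16q²`
  have h2p0 : ((2 : ℤ) : ZMod p) ≠ 0 := by have := hcp 1 0; norm_num at this; exact_mod_cast this
  have h14p0 : ((14 : ℤ) : ZMod p) ≠ 0 := by have := hcp 1 1; norm_num at this; exact_mod_cast this
  have h2sq : IsSquare ((2 : ℤ) : ZMod p) := (legendreSym.eq_one_iff p h2p0).mp h2p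
  have h14sq : IsSquare ((14 : ℤ) : ZMod p) :=
    (legendreSym.eq_one_iff p h14p0).mp (by rw [show (14 : ℤ) = 2 * 7 by norm_num, legendreSym.mul, h2p, h7p]; norm_num)
  have hqsq : IsSquare ((q : ℤ) : ZMod p) := (legendreSym.eq_one_iff p hqp0).mp hqp_p
  have h112q : ((112 * (q : ℤ) ^ 2 : ℤ) : ZMod p) ≠ 0 := by
    have h112 := hcp 4 1; norm_num at h112
    push_cast; exact mul_ne_zero (by exact_mod_cast h112) (pow_ne_zero 2 (by exact_mod_cast hqp0))
  have h16q : ((16 * (q : ℤ) ^ 2 : ℤ) : ZMod p) ≠ 0 := by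
    have h16 := hcp 4 0; norm_num at h16
    push_cast; exact mul_ne_zero (by exact_mod_cast h16) (pow_ne_zero 2 (by exact_mod_cast hqp0))
  -- `u = −qp ≡ 1 (mod 8)` for the classes `2, 14`
  have h8 : (8 : ℤ) ∣ -((q : ℤ) * p) - 1 := by
    have hqp8 : (q * p) % 8 = 7 := by rw [Nat.mul_mod, hq8, hp8]
    have h8n : (8 : ℤ) ∣ ((q * p : ℕ) : ℤ) + 1 := by omega
    have e : -((q : ℤ) * p) - 1 = -( ((q * p : ℕ) : ℤ) + 1) := by push_cast; ring
    rw [e]; exact (dvd_neg).mpr h8n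
  have hb : (112 * ((q : ℤ) * p) ^ 2 : ℤ) ≠ 0 := by positivity
  intro d hd
  rw [mem_twoIsogenySelmerGroup_iff hb] at hd
  obtain ⟨hsqf, ⟨d', hdd'⟩, hloc⟩ := hd
  have hd'eq : (112 * ((q : ℤ) * p) ^ 2 : ℤ) / d = d' := by rw [hdd', Int.mul_ediv_cancel_left _ hsqf.ne_zero]
  rw [hd'eq] at hloc
  obtain ⟨hreal, hpadic⟩ := hloc
  -- negatives die at `ℝ`
  have hdpos : 0 < d := by
    rcases lt_or_gt_of_ne hsqf.ne_zero with hneg | hpos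
    · exfalso
      have hbpos : (0 : ℤ) < 112 * ((q : ℤ) * p) ^ 2 := by positivity
      have hd'neg : d' < 0 := by
        by_contra hcon
        nlinarith [mul_nonpos_iff.mpr (Or.inr ⟨hneg.le, le_of_not_gt hcon⟩)]
      have ha : (-21 * ((q : ℤ) * p)) ≤ 0 := by
        have : (0 : ℤ) ≤ (q : ℤ) * p := by positivity
        linarith
      exact not_isSoluble_real_twoIsogenyQuartic_of_neg hneg hd'neg ha hreal
    · exact hpos
  -- the `q`-classes die at `q`
  have hqd : ¬ (q : ℤ) ∣ d := by
    rintro ⟨e, rfl⟩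
    have h1 : e * d' = 112 * q * p ^ 2 := mul_left_cancel₀ hq0 (by linear_combination (-1 : ℤ) * hdd')
    have h3 : (q : ℤ) ∣ e * d' := ⟨112 * p ^ 2, by rw [h1]; ring⟩
    rcases hqZ.dvd_or_dvd h3 with h4 | h4
    · obtain ⟨e₁, rfl⟩ := h4
      exact hqZ.not_unit (hsqf (q : ℤ) ⟨e₁, by ring⟩)
    · obtain ⟨e', rfl⟩ := h4
      have hm : e * e' = 112 * p ^ 2 := mul_left_cancel₀ hq0 (by linear_combination h1)
      exact not_isSoluble_padic_of_prime_dvd_coeffs (p := q) (c := -21 * p) (by ring) rfl rfl hm hns_disc_q (hpadic q)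
  -- `d ∣ 14qp` prime to `q`: `d ∣ 14p`
  have h0 : d ∣ 112 * ((q : ℤ) * p) ^ 2 := ⟨d', hdd'⟩
  have h1 : d ∣ (14 * ((q : ℤ) * p)) ^ 4 := h0.trans ⟨343 * ((q : ℤ) * p) ^ 2, by ring⟩
  have h14qp : d ∣ 14 * ((q : ℤ) * p) := (hsqf.dvd_pow_iff_dvd (by norm_num)).mp h1
  have hcopq : IsCoprime d (q : ℤ) := ((hqZ.irreducible.coprime_iff_not_dvd).mpr hqd).symm
  have h14p : d ∣ 14 * (p : ℤ) := by
    have : d ∣ (q : ℤ) * (14 * p) := by rw [show (q : ℤ) * (14 * p) = 14 * (q * p) by ring]; exact h14qp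
    exact hcopq.dvd_of_dvd_mul_left this
  by_cases hpd : (p : ℤ) ∣ d
  · -- `d = p·e`, `e ∣ 14`: `p, 7p` die at `p`; `2p, 14p` at `2`
    exfalso
    obtain ⟨e, rfl⟩ := hpd
    have he14 : e ∣ 14 := by
      have : (p : ℤ) * e ∣ (p : ℤ) * 14 := by rw [mul_comm (p : ℤ) 14]; exact h14p
      exact (mul_dvd_mul_iff_left hp0).mp this
    have hepos : 0 < e := pos_of_mul_pos_right hdpos (by positivity)
    have hele : e ≤ 14 := Int.le_of_dvd (by norm_num) he14
    have hd'e : e * d' = 112 * q ^ 2 * p := mul_left_cancel₀ hp0 (by linear_combination (-1 : ℤ) * hdd')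
    interval_cases e <;> try omega
    · -- `d = p`: `d′ = p·112q²`
      exact not_isSoluble_padic_class_p_oddPlusPOneAlpha hp8 hp7 hα h14sq hqsq h112q rfl
        (show d' = (p : ℤ) * (112 * (q : ℤ) ^ 2) by linarith) (hpadic p)
    · -- `d = 2p`: dies at `2`
      exact not_isSoluble_two_class_twoP_oddPlusPOne hq8 hp8 rfl (by ring)
        (show d' = 56 * ((q : ℤ) ^ 2 * p) by linarith) (hpadic 2)
    · -- `d = 7p`: `d′ = p·16q²`
      exact not_isSoluble_padic_class_sevenP_oddPlusPOneAlpha hp8 hp7 hα h2sq hqsq h16q rfl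
        (show d' = (p : ℤ) * (16 * (q : ℤ) ^ 2) by linarith) (hpadic p)
    · -- `d = 14p`: dies at `2`
      exact not_isSoluble_two_class_fourteenP_oddPlusPOne hq8 hp8 rfl (by ring)
        (show d' = 8 * ((q : ℤ) ^ 2 * p) by linarith) (hpadic 2)
  · -- `d ∣ 14`, `d > 0`: `2, 14` die at `2`
    have hcopp : IsCoprime d (p : ℤ) := ((hpZ.irreducible.coprime_iff_not_dvd).mpr hpd).symm
    have hd14 : d ∣ 14 := hcopp.dvd_of_dvd_mul_right h14p
    have hle : d ≤ 14 := Int.le_of_dvd (by norm_num) hd14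
    simp only [Finset.mem_insert, Finset.mem_singleton]
    interval_cases d <;> try omega
    · exact absurd (hpadic 2) (not_isSoluble_two_class_two_odd (u := -((q : ℤ) * p)) h8 (by ring) rfl (by rw [neg_sq]; linarith))
    · exact absurd (hpadic 2) (not_isSoluble_two_class_fourteen_odd (u := -((q : ℤ) * p)) h8 (by ring) rfl (by rw [neg_sq]; linarith))

/-- **`#S(−21qp, 112q²p²) ≤ 2`** on a71+ (sharp). [cite: SilvermanAEC2009, Prop. X.4.9 and Example X.4.10] -/
theorem card_twoIsogenySelmerGroup_oddTwoPrimesTwist_le_two_plusPOneAlpha (hq8 : q % 8 = 7) (hq7 : jacobiSym q 7 = -1) (hp8 : p % 8 = 1)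
    (hp7 : legendreSym p (-7) = 1) (hα : ¬ ∃ x : ZMod p, x ^ 4 = -7) (hpq : jacobiSym p q = 1) :
    (twoIsogenySelmerGroup (-21 * ((q : ℤ) * p)) (112 * ((q : ℤ) * p) ^ 2)).card ≤ 2 :=
  (Finset.card_le_card (twoIsogenySelmerGroup_oddTwoPrimesTwist_subset_pair_plusPOneAlpha hq8 hq7 hp8 hp7 hα hpq)).trans Finset.card_le_two

end SelmerSOdd

end Summit.BirchSwinnertonDyer.BirchSwinnertonDyer.Theorems.GoldfeldGoodTwists

end
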